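import Summits.CriticalPhenomena.PercolationContinuityZ3.Theorems.Transplant.SkelPhiCellsWeakG
import Summits.CriticalPhenomena.PercolationContinuityZ3.Theorems.Transplant.SkelPhiQStepsNMaps
import HarnessLib

/-!
# Quasi-step rung (N3-b), LEVEL 1, row β4 of WAVE-Q-MANIFEST under (ι) := `Skelφ.QStepsN G φ M`: THE FINE CELL MAP HAS WEAK STEPS when the chart has only
# exact-footprint quasi-steps — `WeakSteps G (fineSkel φ t A n h vα vβ c₀ c₁ s₀ s₁ D)` from `QStepsN G φ M` (the `×M` twin of `Skelφ.weakSteps_fineSkel`, which assumed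
# `Steps G φ`; item Q1 of the manifest DISSOLVES under the exact footprint: the FIRST EDGE of a link is non-retreating)

builds on p205010 (kernel theorem, internal audit signed; external expert review pending) — nothing in this file uses p205010; nothing here is a claim about any open node; no carrier,
no node, no definition.  Lane `prim-bschramm`, seat `prim-bschramm-gen-1` (gen 4; GEN pen).  Helper file (`--supports stmt-CriticalPhenomena-4575 --as helper`).
WHY (HOME/WAVE-Q-MANIFEST.md v0.3 §9 row β4; refuter p5-g28 F2 'Q1: the first edge of a `LinkN` goes to a vertex with F = F w or to w′').  «SkelPhiCellsWeakG» `weakSteps_fineSkel`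
picks, for each direction, the single φ-step whose linear-form change has the right sign; its four users («SkelNegParamsFineA», «SkelPhiCellsFineGeomT», «SkelPhiCellsSmallMV»,
«TwoAxisParaCellsFineFrame») feed `exists_adj_upBox/downBox` and the separating geometry.  Under `QStepsN G φ M` the same neighbour is the FIRST EDGE of the corresponding link
(`QStepsN.exists_adj_eq_or`, «SkelPhiQStepsNMaps»): it carries the start's φ-value (cell map unchanged) or the moved value (the tree's case) — either way non-retreating.
* **`weakSteps_fineSkel_of_qStepsN`** (same statement as `weakSteps_fineSkel` with `hstep : Steps G φ ↦ hq : QStepsN G φ M`; ADJACENT neighbour, no cost).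
[cite: KozmaNitzan2024, §4 Lemma 10 Step III (p. 19)] [cite: MartineauTassion2017, §4.3]
-/

noncomputable section

open scoped Classical

namespace Summit.CriticalPhenomena.PercolationContinuityZ3.Theorems.Transplant

namespace Skelφ

open Literature.Probability.Percolation Literature.Probability.LatticeModels SimpleGraph

variable {V : Type} [DecidableEq V] {G : SimpleGraph V} [G.LocallyFinite]

omit [DecidableEq V] [G.LocallyFinite] in
/-- **The fine cell map has weak steps under exact-footprint quasi-steps of the fine map** (twin of `weakSteps_fineSkel`: the first edge of the realising link either keeps
`φ` — hence the cell map — or is the single step of the tree's proof). [this work] -/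
theorem weakSteps_fineSkel_of_qStepsN {φ : V → Site 2} {M : ℕ} (hq : QStepsN G φ M) (t : V) {A n h vα vβ c₀ c₁ s₀ s₁ D : ℤ} (hD : 0 < D) (hc₀ : 0 ≤ c₀)
    (hc₁ : 0 ≤ c₁) : WeakSteps G (fineSkel φ t A n h vα vβ c₀ c₁ s₀ s₁ D) := by
  intro y i σ
  have key : ∀ (j : Fin 2) (d : ℤ) (L : Site 2 → ℤ) (c s : ℤ), 0 ≤ c →
      (∀ (x : Site 2) (τ : ℤ), L (x + Pi.single j τ) = L x + τ * d) →
      ∃ m, G.Adj y m ∧ 0 ≤ (σ : ℤ) * (TwoAxis.Para.coarse c s D (L (relφ φ t m)) - TwoAxis.Para.coarse c s D (L (relφ φ t y))) := by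
    intro j d L c s hc hL
    have hτ : ∃ τ : ℤˣ, 0 ≤ (σ : ℤ) * ((τ : ℤ) * d) := by
      rcases le_or_gt 0 ((σ : ℤ) * d) with hd | hd
      · exact ⟨1, by rw [Units.val_one, one_mul]; exact hd⟩
      · exact ⟨-1, by rw [Units.val_neg, Units.val_one, neg_one_mul, mul_neg]; linarith⟩
    obtain ⟨τ, hτd⟩ := hτ
    obtain ⟨m, hadj, hm⟩ := hq.exists_adj_eq_or y j τ
    refine ⟨m, hadj, ?_⟩
    rcases hm with hφ | hφ
    · -- the first edge keeps the fine map: the cell map does not move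
      have : relφ φ t m = relφ φ t y := by funext k; rw [relφ_apply, relφ_apply, hφ]
      rw [this, sub_self, mul_zero]
    · rw [relφ_of_step (t := t) hφ, hL]
      rcases Int.units_eq_one_or σ with rfl | rfl
      · rw [Units.val_one, one_mul] at hτd ⊢
        exact sub_nonneg.2 (TwoAxis.Para.coarse_mono hc hD (by linarith))
      · rw [Units.val_neg, Units.val_one, neg_one_mul] at hτd ⊢
        rw [neg_nonneg] at hτd
        rw [neg_sub, sub_nonneg]
        exact TwoAxis.Para.coarse_mono hc hD (by linarith)
  fin_cases i
  · obtain ⟨m, hadj, hm⟩ := key 0 (A * vβ) (TwoAxis.Para.lam0 A vα vβ) c₀ s₀ hc₀ fun x τ => by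
      simp [TwoAxis.Para.lam0]; ring
    exact ⟨m, hadj, by simpa [fineSkel] using hm⟩
  · obtain ⟨m, hadj, hm⟩ := key 1 (A * n) (TwoAxis.Para.lam1 A n h) c₁ s₁ hc₁ fun x τ => by
      simp [TwoAxis.Para.lam1, TwoAxis.Para.bp]; ring
    exact ⟨m, hadj, by simpa [fineSkel] using hm⟩

end Skelφ

end Summit.CriticalPhenomena.PercolationContinuityZ3.Theorems.Transplant

end
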